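import Summits.AtomisticToContinuum.Crystallization.Theses.FluxTubeKepler
import Summits.AtomisticToContinuum.Crystallization.Theorems.ChargedEnergyGap.Negative.NoBoundaryReduction

/-!
# `FluxCellKepler` (stmt-AtomisticToContinuum-15221), line `Sketch` — helper: the boundary
# allowance `C · N^(2/3)` in the τ-free defect pricing is not load-bearing

The skeleton's τ-free stub `stub_defectPricedExcess` prices the non-layered ("bad") sites of a
`δ`-separated finite configuration linearly against the excess energy `E_LJ(x) − N · e*`,
`e* = ⨅_Q e(Q)`.  This file certifies that weakening the pricing by a boundary allowance
`C · N^(2/3)` gains nothing: if `c · #bad_(R,η)(x) − C · N^(2/3) ≤ E_LJ(x) − N · e*` holds on all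
`δ`-separated finite injective `x`, then already `c · #bad_(R,η)(x) ≤ E_LJ(x) − N · e*` on the same
configurations, with the SAME `c` (`stub_pricedExcessNoAllowance`).

Proof: amplification by far translated copies (`ChargedEnergyGapNegative.copiesFin`), exactly as
in `ChargedEnergyGapNegative.noBoundaryAt_of_gapWith`.  For `M = m³` copies of `x` at spacing
`L = 2 D(x) + |max R (R + η)| + δ + 1` along `e₀`:
* the copies are injective and `δ`-separated (cross-copy distances are `≥ L − 2 D ≥ δ`);
* `E(copies) ≤ M · E(x)` (cross-copy distances are `≥ 1`, where `V_LJ ≤ 0`);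
* site `(c, i)` of the copies is `(R, η)`-layered-good iff site `i` of `x` is: every relative
  position of norm `≤ R + η` (resp. `≤ R`) seen from a site comes from its own copy, and the
  relative positions inside one copy are those of `x` (`match_copiesFin_iff`); hence
  `#bad(copies) = M · #bad(x)` (`card_eq_mul`);
* so `c · M · #bad(x) − C · m² · N^(2/3) ≤ M · (E(x) − N · e*)` for every `m`; divide by
  `M = m³` and let `m → ∞`.
No sign condition on `c`, `C`, `R`, `η` and no lower bound on `N` is needed, and nothing about
`e*` is used (the argument is carried out for an arbitrary real `e` and an arbitrary defect
predicate stable under far copies, `pricing_noAllowance_of_transfer`).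
-/

noncomputable section

namespace Summit.AtomisticToContinuum.Crystallization.Theorems.FluxCellKeplerSketchNoAllowance

open scoped BigOperators
open Literature.MathematicalPhysics.StatisticalMechanics
open Summit.AtomisticToContinuum.Crystallization.Theorems.ChargedEnergyGapNegative

/-! ## Far copies: relative positions, separation, matching -/

/-- Relative positions inside one copy are those of `x`. [folklore] -/
private theorem sub_copies_of_fst_eq {N : ℕ} (M : ℕ) (L : ℝ) (x : Fin N → E3)
    {q : Fin M × Fin N} {c : Fin M} (hc : q.1 = c) (i : Fin N) :
    copies M L x q - copies M L x (c, i) = x q.2 - x i := by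
  obtain ⟨c', j⟩ := q
  simp only at hc
  subst hc
  simp [copies]

/-- Relative positions across different copies have norm `≥ L − 2 D(x)`. [folklore] -/
private theorem le_norm_sub_copies_ne {N : ℕ} (M : ℕ) {L : ℝ} (hL : 0 ≤ L) (x : Fin N → E3)
    {q : Fin M × Fin N} {c : Fin M} (i : Fin N) (hc : q.1 ≠ c) :
    L - 2 * Dsum x ≤ ‖copies M L x q - copies M L x (c, i)‖ := by
  rw [← dist_eq_norm]
  exact le_dist_copies_ne M hL x hc

/-- The copies of a `δ`-separated configuration are `δ`-separated once `δ ≤ L − 2 D(x)`. [folklore] -/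
private theorem copiesFin_separated {N : ℕ} (M : ℕ) {L δ : ℝ} {x : Fin N → E3} (hL : 0 ≤ L)
    (hδ : δ ≤ L - 2 * Dsum x) (hsep : ∀ i j, i ≠ j → δ ≤ dist (x i) (x j)) :
    ∀ a b : Fin (M * N), a ≠ b → δ ≤ dist (copiesFin M L x a) (copiesFin M L x b) := by
  intro a b hab
  rw [copiesFin_apply, copiesFin_apply]
  have hpq : finProdFinEquiv.symm a ≠ finProdFinEquiv.symm b :=
    fun h => hab (finProdFinEquiv.symm.injective h)
  generalize finProdFinEquiv.symm a = p at hpq ⊢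
  generalize finProdFinEquiv.symm b = q at hpq ⊢
  obtain ⟨c, i⟩ := p
  obtain ⟨c', j⟩ := q
  by_cases hc : c = c'
  · subst hc
    rw [dist_copies_same]
    exact hsep i j fun h => hpq (by rw [h])
  · exact hδ.trans (le_dist_copies_ne M hL x hc)

/-- **Two-way matching is unchanged in far copies.** For any set `S` of model relative positions,
the `R`-neighbourhood of site `(c, i)` of the copies is two-way `η`-matched with `S` iff the
`R`-neighbourhood of site `i` of `x` is, provided `L − 2 D(x) > max R (R + η)`: relative positions
of norm `≤ R + η` (resp. `≤ R`) only arise inside one copy, where they are those of `x`. [folklore] -/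
private theorem match_copiesFin_iff (S : Set E3) {R η L : ℝ} {M N : ℕ} (x : Fin N → E3)
    (hL0 : 0 ≤ L) (hL1 : R + η < L - 2 * Dsum x) (hL2 : R < L - 2 * Dsum x)
    (c : Fin M) (i : Fin N) :
    ((∀ p ∈ S, ‖p‖ ≤ R → ∃ b : Fin (M * N),
        dist (copiesFin M L x b - copiesFin M L x (finProdFinEquiv (c, i))) p ≤ η) ∧
      (∀ b : Fin (M * N), ‖copiesFin M L x b - copiesFin M L x (finProdFinEquiv (c, i))‖ ≤ R →
        ∃ p ∈ S, dist (copiesFin M L x b - copiesFin M L x (finProdFinEquiv (c, i))) p ≤ η)) ↔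
    ((∀ p ∈ S, ‖p‖ ≤ R → ∃ j : Fin N, dist (x j - x i) p ≤ η) ∧
      (∀ j : Fin N, ‖x j - x i‖ ≤ R → ∃ p ∈ S, dist (x j - x i) p ≤ η)) := by
  simp only [copiesFin_apply, Equiv.symm_apply_apply]
  constructor
  · rintro ⟨h1, h2⟩
    refine ⟨fun p hp hpR => ?_, fun j hj => ?_⟩
    · obtain ⟨b, hb⟩ := h1 p hp hpR
      by_cases hc : (finProdFinEquiv.symm b).1 = c
      · refine ⟨(finProdFinEquiv.symm b).2, ?_⟩
        rwa [sub_copies_of_fst_eq M L x hc i] at hb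
      · exfalso
        have hfar := le_norm_sub_copies_ne M hL0 x i hc
        have hnear := norm_le_insert' (copies M L x (finProdFinEquiv.symm b) - copies M L x (c, i)) p
        rw [dist_eq_norm] at hb
        linarith
    · obtain ⟨p, hp, hpj⟩ := h2 (finProdFinEquiv (c, j))
        (by rw [Equiv.symm_apply_apply, sub_copies_of_fst_eq M L x rfl i]; exact hj)
      refine ⟨p, hp, ?_⟩
      rwa [Equiv.symm_apply_apply, sub_copies_of_fst_eq M L x rfl i] at hpj
  · rintro ⟨h1, h2⟩
    refine ⟨fun p hp hpR => ?_, fun b hb => ?_⟩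
    · obtain ⟨j, hj⟩ := h1 p hp hpR
      refine ⟨finProdFinEquiv (c, j), ?_⟩
      rw [Equiv.symm_apply_apply, sub_copies_of_fst_eq M L x rfl i]
      exact hj
    · by_cases hc : (finProdFinEquiv.symm b).1 = c
      · rw [sub_copies_of_fst_eq M L x hc i] at hb ⊢
        exact h2 _ hb
      · exfalso
        have hfar := le_norm_sub_copies_ne M hL0 x i hc
        linarith

/-- If a predicate on the sites of the copies agrees copywise with a predicate on the sites of
`x`, the copies carry `M` times as many exceptional sites. [folklore] -/
private theorem card_eq_mul {M N : ℕ} (P : Fin (M * N) → Prop) (Q : Fin N → Prop)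
    (h : ∀ (c : Fin M) (i : Fin N), P (finProdFinEquiv (c, i)) ↔ Q i) :
    Nat.card {a : Fin (M * N) // ¬ P a} = M * Nat.card {i : Fin N // ¬ Q i} := by
  have e1 : {a : Fin (M * N) // ¬ P a} ≃ {p : Fin M × Fin N // ¬ Q p.2} := by
    refine finProdFinEquiv.symm.subtypeEquiv fun a => not_congr ?_
    obtain ⟨⟨c, i⟩, rfl⟩ := finProdFinEquiv.surjective a
    rw [Equiv.symm_apply_apply]
    exact h c i
  have e2 : {p : Fin M × Fin N // ¬ Q p.2} ≃ Fin M × {i : Fin N // ¬ Q i} :=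
    { toFun := fun p => (p.1.1, ⟨p.1.2, p.2⟩)
      invFun := fun q => ⟨(q.1, q.2.1), q.2.2⟩
      left_inv := fun _ => rfl
      right_inv := fun _ => rfl }
  rw [Nat.card_congr (e1.trans e2), Nat.card_prod, Nat.card_eq_fintype_card, Fintype.card_fin]

/-! ## Amplification by far copies for an abstract defect predicate -/

/-- **Amplification by far copies.** Let `Good K y i` be any predicate on the sites of finite
configurations which is unchanged in far copies (spacing `L` with `L − 2 D(y) > ρ`).  If
`c · #{¬ Good} − C · K^(2/3) ≤ E_LJ(y) − K · e` for all `δ`-separated finite injective `y`, then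
`c · #{¬ Good} ≤ E_LJ(x) − N · e` for every `δ`-separated finite injective `x`: apply the priced
inequality to `m³` far copies of `x` and let `m → ∞`. [folklore] -/
theorem pricing_noAllowance_of_transfer (Good : ∀ K : ℕ, (Fin K → E3) → Fin K → Prop) (ρ : ℝ)
    (htransfer : ∀ (M K : ℕ) (L : ℝ) (y : Fin K → E3), 0 ≤ L → ρ < L - 2 * Dsum y →
      ∀ (c : Fin M) (i : Fin K),
        Good (M * K) (copiesFin M L y) (finProdFinEquiv (c, i)) ↔ Good K y i)
    {δ c C e : ℝ} (hδ : 0 < δ)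
    (hP : ∀ (K : ℕ) (y : Fin K → E3), Function.Injective y →
      (∀ i j, i ≠ j → δ ≤ dist (y i) (y j)) →
      c * (Nat.card {i : Fin K // ¬ Good K y i} : ℝ) - C * (K : ℝ) ^ (2 / 3 : ℝ) ≤
        interactionEnergy lennardJones y - (K : ℝ) * e)
    (N : ℕ) (x : Fin N → E3) (hx : Function.Injective x)
    (hsep : ∀ i j, i ≠ j → δ ≤ dist (x i) (x j)) :
    c * (Nat.card {i : Fin N // ¬ Good N x i} : ℝ) ≤
      interactionEnergy lennardJones x - (N : ℝ) * e := by
  set B : ℝ := (Nat.card {i : Fin N // ¬ Good N x i} : ℝ) with hB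
  set L : ℝ := 2 * Dsum x + |ρ| + δ + 1 with hL
  have hD := Dsum_nonneg x
  have hρ1 := le_abs_self ρ
  have hρ0 := abs_nonneg ρ
  have hL0 : 0 ≤ L := by rw [hL]; linarith
  have hLρ : ρ < L - 2 * Dsum x := by rw [hL]; linarith
  have hLδ : δ ≤ L - 2 * Dsum x := by rw [hL]; linarith
  have hL1 : 1 ≤ L - 2 * Dsum x := by rw [hL]; linarith
  have hL2 : 2 * Dsum x < L := by linarith
  have key : ∀ M : ℕ, c * ((M : ℝ) * B) - C * ((M : ℝ) * N) ^ (2 / 3 : ℝ) ≤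
      (M : ℝ) * interactionEnergy lennardJones x - (M : ℝ) * N * e := by
    intro M
    have hg := hP (M * N) (copiesFin M L x) (copiesFin_injective M hL2 hx)
      (copiesFin_separated M hL0 hLδ hsep)
    rw [card_eq_mul (Good (M * N) (copiesFin M L x)) (Good N x) (htransfer M N L x hL0 hLρ)] at hg
    push_cast at hg
    have hE := interactionEnergy_copiesFin_le M x hL1
    rw [hB]
    linarith
  refine le_of_not_gt fun hlt => ?_
  have hε0 : 0 < c * B - (interactionEnergy lennardJones x - N * e) := by linarith
  obtain ⟨m₀, hm₀⟩ := exists_nat_gt (C * (N : ℝ) ^ (2 / 3 : ℝ) /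
    (c * B - (interactionEnergy lennardJones x - N * e)))
  have hm1 : C * (N : ℝ) ^ (2 / 3 : ℝ) < ((m₀ + 1 : ℕ) : ℝ) *
      (c * B - (interactionEnergy lennardJones x - N * e)) := by
    rw [div_lt_iff₀ hε0] at hm₀
    push_cast
    nlinarith
  have hm2 : (0 : ℝ) < (((m₀ + 1 : ℕ) : ℝ)) ^ 2 := by positivity
  have hkey := key ((m₀ + 1) ^ 3)
  push_cast [Nat.cast_pow] at hkey
  push_cast at hm1 hm2
  rw [cube_mul_rpow (by positivity) (Nat.cast_nonneg N)] at hkey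
  nlinarith [mul_lt_mul_of_pos_right hm1 hm2, hkey]

/-! ## The stub -/

/-- **The boundary allowance is not load-bearing** (line `Sketch`, stub
`stub_pricedExcessNoAllowance`): a τ-free defect pricing of the `(R, η)`-bad sites with boundary
allowance `C · N^(2/3)` on all `δ`-separated finite injective configurations of `ℝ³` implies the
same pricing with the same constant `c` and NO allowance.  Amplification by far translated
copies (`pricing_noAllowance_of_transfer` with the layered-good predicate, which is unchanged in
far copies by `match_copiesFin_iff`). [folklore] -/
theorem stub_pricedExcessNoAllowance : ∀ (δ c C : ℝ) (R η : ℝ), 0 < δ → (∀ (N : ℕ) (x : Fin N → EuclideanSpace ℝ (Fin 3)), Function.Injective x → (∀ i j, i ≠ j → δ ≤ dist (x i) (x j)) → c * (Nat.card {i : Fin N // ¬ ∃ a : ℝ, 47 / 50 ≤ a ∧ a ≤ 1 ∧ ∃ (A : EuclideanSpace ℝ (Fin 3) →ₗᵢ[ℝ] EuclideanSpace ℝ (Fin 3)) (s : ℤ → ℤ) (z : ℤ → ℝ), IsHaggSeq s ∧ (∀ m : ℤ, 39 / 50 * a ≤ z (m + 1) - z m ∧ z (m + 1) - z m ≤ 17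 / 20 * a) ∧ let S : Set (EuclideanSpace ℝ (Fin 3)) := {p | ∃ m k l : ℤ, p = A (((k : ℝ) • triangularVec₁ a) + ((l : ℝ) • triangularVec₂ a) + ((haggLabel s m : ℝ) • barlowOffset a) + (z m • layerNormal 1))}; (∀ p ∈ S, ‖p‖ ≤ R → ∃ j : Fin N, dist (x j - x i) p ≤ η) ∧ (∀ j : Fin N, ‖x j - x i‖ ≤ R → ∃ p ∈ S, dist (x j - x i) p ≤ η)} : ℝ) - C * (N : ℝ) ^ (2 / 3 : ℝ) ≤ interactionEnergy lennardJones x - (N : ℝ) * ⨅ Q : PeriodicConfiguration 3, Q.energyPerParticle lennardJones) → ∀ (N : ℕ) (x : Fin N → EuclideanSpace ℝ (Fin 3)), Function.Injective x → (∀ i j, i ≠ j → δ ≤ dist (x i) (x j)) → c * (Nat.card {i : Fin N // ¬ ∃ a : ℝ, 47 / 50 ≤ a ∧ a ≤ 1 ∧ ∃ (A : EuclideanSpace ℝ (Fin 3) →ₗᵢ[ℝ] EuclideanSpace ℝ (Fin 3)) (s : ℤ → ℤ) (z : ℤ → ℝ), IsHaggSeq s ∧ (∀ m : ℤ, 39 /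 50 * a ≤ z (m + 1) - z m ∧ z (m + 1) - z m ≤ 17 / 20 * a) ∧ let S : Set (EuclideanSpace ℝ (Fin 3)) := {p | ∃ m k l : ℤ, p = A (((k : ℝ) • triangularVec₁ a) + ((l : ℝ) • triangularVec₂ a) + ((haggLabel s m : ℝ) • barlowOffset a) + (z m • layerNormal 1))}; (∀ p ∈ S, ‖p‖ ≤ R → ∃ j : Fin N, dist (x j - x i) p ≤ η) ∧ (∀ j : Fin N, ‖x j - x i‖ ≤ R → ∃ p ∈ S, dist (x j - x i) p ≤ η)} : ℝ) ≤ interactionEnergy lennardJones x - (N : ℝ) * ⨅ Q : PeriodicConfiguration 3, Q.energyPerParticle lennardJones := by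
  intro δ c C R η hδ hP N x hx hsep
  refine pricing_noAllowance_of_transfer _ (max R (R + η)) ?_ hδ hP N x hx hsep
  intro M K L y hL0 hρ c' i
  obtain ⟨hρ1, hρ2⟩ := max_lt_iff.1 hρ
  constructor
  · rintro ⟨a, ha1, ha2, A, s, z, hs, hz, h⟩
    exact ⟨a, ha1, ha2, A, s, z, hs, hz, (match_copiesFin_iff _ y hL0 hρ2 hρ1 c' i).1 h⟩
  · rintro ⟨a, ha1, ha2, A, s, z, hs, hz, h⟩
    exact ⟨a, ha1, ha2, A, s, z, hs, hz, (match_copiesFin_iff _ y hL0 hρ2 hρ1 c' i).2 h⟩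

end Summit.AtomisticToContinuum.Crystallization.Theorems.FluxCellKeplerSketchNoAllowance

end
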